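import Literature.Analysis.FluidPDE.OnsagerCCFSFlux
import Literature.Analysis.FunctionSpaces.DistributionalConstancy
import HarnessLib

/-!
# Sharp Onsager rigidity on `T³` (CCFS 2008, Thm 3.3): the reduction to the named facts

One-step companion of `Literature.Analysis.FluidPDE.OnsagerCCFSFlux`: the energy of a weak
Euler solution of class `L³_t B^{1/3}_{3,c₀}` is distributionally constant on `(0,T)`
(`Turb.setIntegral_deriv_mul_energyProfile_eq_zero`, from the named facts F₁, F₃, F₄ of that
file), hence a.e. constant by the du Bois-Reymond lemma
(`Literature.Analysis.FunctionSpaces.ae_eq_const_of_forall_setIntegral_deriv_mul_eq_zero`, `DistributionalConstancy`,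
Brezis 2011, Lemma 8.1) — which is `Turb.onsager_rigidity_ccfs`
(Cheskidov–Constantin–Friedlander–Shvydkoy 2008, Thm 3.3, in the tree's transcription).
Through the accepted `Turb.onsager_rigidity_of_ccfs` the same three facts give the
Constantin–E–Titi theorem `Turb.onsager_rigidity`.

## References

* A. Cheskidov, P. Constantin, S. Friedlander, R. Shvydkoy, *Energy conservation and Onsager's
  conjecture for the Euler equations*, Nonlinearity 21 (2008) = arXiv:0704.0759, Thm 3.3.
* H. Brezis, *Functional Analysis, Sobolev Spaces and PDE* (Springer 2011), Lemma 8.1.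
-/

noncomputable section

open MeasureTheory Set Function Filter Topology

namespace Literature.Analysis.FluidPDE

section Turb

open Torus FunctionSpaces.Torus

/-- **Reduction of the sharp Onsager rigidity theorem to the named facts.** CCFS 2008, Thm 3.3
on `T³` (`Turb.onsager_rigidity_ccfs`) follows from the mollified energy balance
(`IsWeakEulerSolutionOn.energyBalance_vecConv`, CCFS (11)), the vanishing of the total flux in
the class `L³_t B^{1/3}_{3,c₀}` (`tendsto_lintegral_cetFlux`, CCFS (13) and Thm 3.3) and the
`L¹(0,T)` convergence of the mollified energies (`tendsto_lintegral_kineticEnergy_vecConv_sub`):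
these give `∫ θ' E(u(t)) dt = 0` for all `θ ∈ C_c^∞(0,T)`
(`setIntegral_deriv_mul_energyProfile_eq_zero`), and the du Bois-Reymond lemma
(the accepted `Literature.Analysis.FunctionSpaces.ae_eq_const_of_forall_setIntegral_deriv_mul_eq_zero` of
`DistributionalConstancy`, Brezis 2011, Lemma 8.1) makes the energy a.e. equal to a constant on
`(0,T)`, which is the a.e.-in-time conservation asserted.
[cite: CCFS2008, Thm 3.3] -/
theorem onsager_rigidity_ccfs_of
    (h1 : IsWeakEulerSolutionOn.energyBalance_vecConv (d := Fin 3))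
    (h3 : tendsto_lintegral_cetFlux (d := Fin 3))
    (h4 : tendsto_lintegral_kineticEnergy_vecConv_sub (d := Fin 3)) :
    onsager_rigidity_ccfs := by
  intro T u hu hB
  have hm' : AEStronglyMeasurable (uncurry u) ((volume.restrict (Ioo 0 T)).prod volume) :=
    aestronglyMeasurable_uncurry_restrict_prod_of_stLift hu.1
  have he : IntegrableOn (fun t => energyProfile u t) (Ioo 0 T) :=
    integrableOn_kineticEnergy hm' hu.2.1
  obtain ⟨C, hC⟩ := FunctionSpaces.ae_eq_const_of_forall_setIntegral_deriv_mul_eq_zero he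
    fun θ hθ hθc hθT => setIntegral_deriv_mul_energyProfile_eq_zero h1 h3 h4 hu hB hθ hθc hθT
  filter_upwards [hC] with s hs
  filter_upwards [hC] with t ht
  rw [hs, ht]


/-- The same three named facts prove the Constantin–E–Titi form `Turb.onsager_rigidity`
(through the accepted `Turb.onsager_rigidity_of_ccfs`). [cite: CCFS2008, §3.2] -/
theorem onsager_rigidity_of_facts
    (h1 : IsWeakEulerSolutionOn.energyBalance_vecConv (d := Fin 3))
    (h3 : tendsto_lintegral_cetFlux (d := Fin 3))
    (h4 : tendsto_lintegral_kineticEnergy_vecConv_sub (d := Fin 3)) :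
    onsager_rigidity :=
  onsager_rigidity_of_ccfs (onsager_rigidity_ccfs_of h1 h3 h4)

end Turb

end Literature.Analysis.FluidPDE
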